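import Literature.AnabelianGeometry.EtaleTheta.SettingModelKrullCuspThm16Origin
import HarnessLib

/-!
# The cusped untwisted Krull model with the INDEX-2 inertia `c^{2Ẑ}`: `curveκ₂`, `ThetaSetting.modelκ₂` — a twin of
# abc-iut-L2-t10's `modelκ′` whose cusp inertia is the subgroup of SQUARES of the commutator axis (part 1: the records)

S. Mochizuki, *The étale theta function …*, Publ. RIMS **45** (2009) [EtTh], §1 p. 12 («`Δ_X` … a profinite free group
on 2 generators»), p. 13 («any decomposition group of a cusp of `Y^log`»), Def. 2.1 p. 35 («`D_x → Π^Θ_X` … maps the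
inertia group `I_x ⊆ D_x` isomorphically onto `Δ_Θ`») [cite: MochizukiEtTh2009, Def 2.1 p.35]; [SemiAnbd] §6 p. 71
(«`D_x` always surjects onto an open subgroup of `G_K`», «`I_x` is isomorphic to `Ẑ(1)` if `x` is a cusp»)
[cite: MochizukiSemiAnbd2006, §6 p.71].  Cell abc-iut, layer L2 (NV lane), seat abc-iut-w5-d051 (gen 4; origin-profile /
NV-census lineage), over abc-iut-L2-t10's untwisted KRULL carrier (`SettingModelKrullSemidirect` / `…Coverings` /
`…Cusp`: `Π^tp_X := Γ ⋊_{θ∘1} G_{ℚ_p}`, Krull topology on the Galois factor) and abc-iut-w5-d165's commutator axis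
(`SettingModel2CommutatorCusp`: `cPowGfp : Ẑ →ₜ* Γ`, `t ↦ (c^t, 0)`, `cAxisGfp = c^Ẑ`), all BY NAME, nothing restated.

WHY (census item C3 «`toTheta(I_x) = Δ_Θ`», abc-iut-L2-t7's `CuspLaws.map_toTheta_inertia`).  abc-iut-w5-d051's
`Sec1EllPowersSeparated` / `Sec1NoCentralCuspAtJointOrigin` DERIVE the `⊆` half of C3 from the Tate-module clause + R2.
Is the `⊇` half («the inertia GENERATES `Δ_Θ`») a consequence of the OTHER §1 clauses — `IsEtThOrigin`, `IsThm16Origin`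
(R1, R2, cusp, R3, TM₂), the parameter bundle `OncePuncturedData`, the cusp laws C16 (unique cusp) and C9 (continuous
section)?  NO: this file builds the witness.  The typed cusp datum of [SemiAnbd] §6 (`TemperedCurve`: `decomp`,
`isClosed_decomp`, `isOpen_aug_decomp`, `inertia_equiv_zHat`) only asks for a closed decomposition group with open
image and an inertia abstractly `≃ₜ* Ẑ`; the subgroup of SQUARES `c^{2Ẑ} := {c^{2t}} ⊆ c^Ẑ` of the commutator axis is
again `≃ₜ* Ẑ` (`Ẑ` is torsion-free, `ZHatCompletion.eq_one_of_pow_eq_one`), so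

* `cSqPowGfp : Ẑ →ₜ* Γ`, `t ↦ c^{t²}` (`:= cPowGfp (t·t)`), injective, a closed embedding; `cSqAxisGfp = c^{2Ẑ} ≤ cAxisGfp`,
  `cSqAxisGfpEquiv : c^{2Ẑ} ≃ₜ* Ẑ`;
* the cusp datum `cuspDecompκ₂ := {g | g.left ∈ c^{2Ẑ}} = c^{2Ẑ} ⋊ G_{ℚ_p}` (a subgroup: trivial action), closed,
  `aug(D_x) = G_{ℚ_p}` (open), inertia `inl(c^{2Ẑ}) ≃ₜ* Ẑ` (`inertiaEquivκ₂`);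
* the records **`curveκ₂ : TemperedCurve p`** (= `curveκ` with `Pt := Unit`, the point a cusp, `D_x := cuspDecompκ₂`) and
  **`ThetaSetting.modelκ₂`** (= `modelκ′` VERBATIM over `curveκ₂`: same `Π^tp_X`, `toZ`, theta quotients, `Y_N`, `Z_N`);
* `modelκ₂_isEtThOrigin`, (P1)–(P4) and `nonempty_oncePuncturedData_modelκ₂` (the parameter bundle with NO binder),
  `inertia_modelκ₂_eq : I_x = inl(c^{2Ẑ})`.

Part 2 (`SettingModelKrullCuspSqAxisOrigin.lean`, proof-only) shows `IsThm16Origin`, C16, C9 at `modelκ₂` and the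
FAILURE of C3: `toTheta(I_x) = 2·Δ_Θ ≠ Δ_Θ` — so the `⊇` half of C3 is INDEPENDENT of all the other typed §1 clauses
available without `IsTateOrigin` (which no product-type cusp carrier can have, `Sec1NoCentralCuspAtJointOrigin`).
CLASS (b) MODEL file: definitions = the two carrier records and their cusp-datum ingredients (no `Prop`-valued def, no
notation, instances only re-keyed `Normal` instances on the NEW record `curveκ₂`, exactly as `SettingModelKrullCusp`).
HONEST LABEL: SEMI-SYNTHETIC model (trivial Galois action on `Γ`, synthetic cusp on a sub-axis) — consistency /
independence evidence for the typed interface only, not the tempered `π₁` of a curve; nothing of [EtTh] asserted; no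
side taken on [IUTchIII] Cor. 3.12; typed ≠ proved.
-/

noncomputable section

namespace Literature.AnabelianGeometry.EtaleTheta.SettingModel

open Literature.AnabelianGeometry.SemiGraphs _root_.Topology _root_.Function
open Literature.AnabelianGeometry.AbsoluteAnabelian
open scoped commutatorElement Pointwise

/-! ## §1. The square sub-axis `c^{2Ẑ} ⊆ Γ` -/

/-- **`t ↦ c^{2t} = (c^t)² : Ẑ → Γ`** (in the multiplicative notation of `Ẑ`: `t ↦ cPowGfp (t·t)`).
[cite: MochizukiEtTh2009, §1 p.12] -/
def cSqPowGfp : ZH →ₜ* Gfp where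
  toFun t := cPowGfp (t * t)
  map_one' := by rw [mul_one, map_one]
  map_mul' s t := by
    rw [← map_mul]
    congr 1
    rw [mul_assoc, mul_assoc, ← mul_assoc t s t, ZHatCompletion.mul_comm t s, mul_assoc]
  continuous_toFun := cPowGfp.continuous.comp (continuous_id.mul continuous_id)

/-- [cite: MochizukiEtTh2009, §1 p.12] -/
theorem cSqPowGfp_apply (t : ZH) : cSqPowGfp t = cPowGfp (t * t) := rfl

/-- `t ↦ c^{2t}` is injective (`Ẑ` is torsion-free: `(s t⁻¹)² = 1 ⇒ s = t`). [cite: MochizukiEtTh2009, §1 p.12] -/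
theorem cSqPowGfp_injective : Injective cSqPowGfp := by
  intro s t h
  have h1 : s * s = t * t := cPowGfp_injective h
  have h2 : (s * t⁻¹) ^ 2 = 1 := by
    calc (s * t⁻¹) ^ 2 = s * (t⁻¹ * s) * t⁻¹ := by rw [pow_two]; group
      _ = s * (s * t⁻¹) * t⁻¹ := by rw [ZHatCompletion.mul_comm t⁻¹ s]
      _ = (s * s) * (t⁻¹ * t⁻¹) := by group
      _ = (t * t) * (t⁻¹ * t⁻¹) := by rw [h1]
      _ = 1 := by group
  exact mul_inv_eq_one.mp (ZHatCompletion.eq_one_of_pow_eq_one two_ne_zero h2)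

/-- `t ↦ c^{2t}` is a closed embedding (continuous injective, compact source, Hausdorff target).
[cite: MochizukiEtTh2009, §1 p.12] -/
theorem isClosedEmbedding_cSqPowGfp : _root_.Topology.IsClosedEmbedding cSqPowGfp :=
  cSqPowGfp.continuous.isClosedEmbedding cSqPowGfp_injective

/-- **The square sub-axis `c^{2Ẑ} ⊆ Γ`** (index `2` in the commutator axis `c^Ẑ`). [cite: MochizukiEtTh2009, Def 2.1 p.35] -/
def cSqAxisGfp : Subgroup Gfp := cSqPowGfp.toMonoidHom.range

/-- [cite: MochizukiEtTh2009, §1 p.12] -/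
theorem mem_cSqAxisGfp_iff (q : Gfp) : q ∈ cSqAxisGfp ↔ ∃ t, cSqPowGfp t = q := Iff.rfl

/-- [cite: MochizukiEtTh2009, §1 p.12] -/
theorem cSqPowGfp_mem_cSqAxisGfp (t : ZH) : cSqPowGfp t ∈ cSqAxisGfp := ⟨t, rfl⟩

/-- `c^{2Ẑ} ≤ c^Ẑ`. [cite: MochizukiEtTh2009, §1 p.12] -/
theorem cSqAxisGfp_le_cAxisGfp : cSqAxisGfp ≤ cAxisGfp := by
  rintro _ ⟨t, rfl⟩
  exact ⟨t * t, rfl⟩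

/-- `c^{2Ẑ}` is closed in `Γ`. [cite: MochizukiSemiAnbd2006, §6 p.71] -/
theorem isClosed_cSqAxisGfp : IsClosed (cSqAxisGfp : Set Gfp) := by
  change IsClosed (Set.range cSqPowGfp.toMonoidHom)
  exact isClosedEmbedding_cSqPowGfp.isClosed_range

/-- `c^{2Ẑ} ≤ Ker(Γ ↠ ℤ)` (the `Π^tp_Y` direction). [cite: MochizukiEtTh2009, §1 p.13] -/
theorem cSqAxisGfp_le_ker_gfpSnd : cSqAxisGfp ≤ gfpSnd.ker :=
  cSqAxisGfp_le_cAxisGfp.trans cAxisGfp_le_ker_gfpSnd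

/-- A conjugate of the square sub-axis lies in the corresponding conjugate of the axis. [cite: MochizukiEtTh2009, §1 p.13] -/
theorem conj_cSqAxisGfp_le_conj_cAxisGfp (γ₀ : Gfp) : MulAut.conj γ₀ • cSqAxisGfp ≤ MulAut.conj γ₀ • cAxisGfp := by
  intro x hx
  rw [Subgroup.mem_smul_pointwise_iff_exists] at hx ⊢
  obtain ⟨c, hc, rfl⟩ := hx
  exact ⟨c, cSqAxisGfp_le_cAxisGfp hc, rfl⟩

/-- **`Ẑ ≃ₜ* c^{2Ẑ}`** (corestriction of the closed embedding `t ↦ c^{2t}`). [cite: MochizukiSemiAnbd2006, §6 p.71] -/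
def zHatEquivCSqAxisGfp : ZH ≃ₜ* cSqAxisGfp :=
  let E : ZH ≃ cSqAxisGfp :=
    { toFun := fun t => ⟨cSqPowGfp t, cSqPowGfp_mem_cSqAxisGfp t⟩
      invFun := fun x => Classical.choose x.2
      left_inv := fun t => cSqPowGfp_injective (Classical.choose_spec (cSqPowGfp_mem_cSqAxisGfp t))
      right_inv := fun x => Subtype.ext (Classical.choose_spec x.2) }
  have hE : Continuous E := cSqPowGfp.continuous.subtype_mk _
  { E with
    map_mul' := fun u v => Subtype.ext (map_mul cSqPowGfp u v)
    continuous_toFun := hE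
    continuous_invFun := Continuous.continuous_symm_of_equiv_compact_to_t2 hE }

/-- **`c^{2Ẑ} ≃ₜ* Ẑ`** — the clause `inertia_equiv_zHat` in the making. [cite: MochizukiSemiAnbd2006, §6 p.71] -/
def cSqAxisGfpEquiv : cSqAxisGfp ≃ₜ* ZHat := zHatEquivCSqAxisGfp.symm

variable (p : ℕ) [Fact p.Prime]

/-! ## §2. The cusp datum `D_x := c^{2Ẑ} ⋊ G_{ℚ_p}` on `Π^tp_X = Γ ⋊_{θ∘1} G_{ℚ_p}` -/

/-- **`D_x := {g | g.left ∈ c^{2Ẑ}}`** — a subgroup because the Galois action on `Γ` is trivial.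
[cite: MochizukiEtTh2009, §1 p.13] -/
def cuspDecompκ₂ : Subgroup (PiTpκ p) where
  carrier := {g | g.left ∈ cSqAxisGfp}
  one_mem' := by
    change (1 : PiTpκ p).left ∈ cSqAxisGfp
    rw [SemidirectProduct.one_left]; exact Subgroup.one_mem _
  mul_mem' {a b} ha hb := by
    change (a * b).left ∈ cSqAxisGfp
    rw [SemidirectProduct.mul_left, actκ_apply_eq]
    exact Subgroup.mul_mem _ ha hb
  inv_mem' {a} ha := by
    change a⁻¹.left ∈ cSqAxisGfp
    rw [SemidirectProduct.inv_left, actκ_apply_eq]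
    exact Subgroup.inv_mem _ ha

/-- [cite: MochizukiEtTh2009, §1 p.13] -/
theorem mem_cuspDecompκ₂_iff (g : PiTpκ p) : g ∈ cuspDecompκ₂ p ↔ g.left ∈ cSqAxisGfp := Iff.rfl

/-- `D_x ≤` abc-iut-L2-t10's commutator-axis datum `c^Ẑ ⋊ G_{ℚ_p}`. [cite: MochizukiEtTh2009, §1 p.13] -/
theorem cuspDecompκ₂_le_cuspDecompκ : cuspDecompκ₂ p ≤ cuspDecompκ p :=
  fun g hg => (mem_cuspDecompκ_iff p g).mpr (cSqAxisGfp_le_cAxisGfp ((mem_cuspDecompκ₂_iff p g).mp hg))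

/-- `D_x` is closed. [cite: MochizukiSemiAnbd2006, §6 p.71] -/
theorem isClosed_cuspDecompκ₂ : IsClosed (cuspDecompκ₂ p : Set (PiTpκ p)) :=
  isClosed_cSqAxisGfp.preimage (Semidirect.continuous_left (isInducing_leftRightκ p))

/-- `aug(D_x) = G_{ℚ_p}`. [cite: MochizukiSemiAnbd2006, §6 p.71] -/
theorem augκ_image_cuspDecompκ₂ : (augκ p) '' (cuspDecompκ₂ p : Set (PiTpκ p)) = Set.univ :=
  Set.eq_univ_of_forall fun σ => ⟨SemidirectProduct.inr σ,
    by rw [SetLike.mem_coe, mem_cuspDecompκ₂_iff, SemidirectProduct.left_inr]; exact Subgroup.one_mem _, rfl⟩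

/-- As subgroups: `aug(D_x) = ⊤`. [cite: MochizukiSemiAnbd2006, §6 p.71] -/
theorem map_augκ_cuspDecompκ₂ : (cuspDecompκ₂ p).map (augκ p).toMonoidHom = ⊤ := by
  apply SetLike.coe_injective
  rw [Subgroup.coe_map, Subgroup.coe_top]
  exact augκ_image_cuspDecompκ₂ p

/-- The inertia `I_x = D_x ∩ Ker(aug) = inl(c^{2Ẑ})`. [cite: MochizukiSemiAnbd2006, §6 p.71] -/
theorem cuspDecompκ₂_inf_ker :
    cuspDecompκ₂ p ⊓ (augκ p).toMonoidHom.ker = cSqAxisGfp.map (SemidirectProduct.inl : Gfp →* PiTpκ p) := by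
  ext g
  rw [Subgroup.mem_inf, mem_cuspDecompκ₂_iff, MonoidHom.mem_ker]
  constructor
  · rintro ⟨hl, hr⟩
    refine ⟨g.left, hl, ?_⟩
    change (augκ p) g = 1 at hr
    rw [augκ_apply] at hr
    exact SemidirectProduct.ext (SemidirectProduct.left_inl _) (by rw [SemidirectProduct.right_inl]; exact hr.symm)
  · rintro ⟨q, hq, rfl⟩
    exact ⟨by rwa [SemidirectProduct.left_inl], by change (augκ p) _ = 1; rw [augκ_apply, SemidirectProduct.right_inl]⟩

/-- `I_x ≃ₜ* c^{2Ẑ}` (first projection). [cite: MochizukiSemiAnbd2006, §6 p.71] -/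
def inertiaSubgroupEquivκ₂ : ↥(cuspDecompκ₂ p ⊓ (augκ p).toMonoidHom.ker) ≃ₜ* cSqAxisGfp where
  toFun g := ⟨g.1.left, g.2.1⟩
  invFun q := ⟨SemidirectProduct.inl q.1,
    ⟨show (SemidirectProduct.inl q.1 : PiTpκ p).left ∈ cSqAxisGfp from q.2, (MonoidHom.mem_ker).mpr rfl⟩⟩
  left_inv g := by
    apply Subtype.ext
    change SemidirectProduct.inl g.1.left = g.1
    have hr : g.1.right = 1 := by
      have h : (augκ p) g.1 = 1 := (MonoidHom.mem_ker).mp g.2.2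
      rwa [augκ_apply] at h
    exact SemidirectProduct.ext (SemidirectProduct.left_inl _) (by rw [SemidirectProduct.right_inl]; exact hr.symm)
  right_inv q := Subtype.ext rfl
  map_mul' g h := Subtype.ext (by
    change (g.1 * h.1).left = g.1.left * h.1.left
    rw [SemidirectProduct.mul_left, actκ_apply_eq])
  continuous_toFun := ((Semidirect.continuous_left (isInducing_leftRightκ p)).comp continuous_subtype_val).subtype_mk _
  continuous_invFun := ((continuous_inlκ p).comp continuous_subtype_val).subtype_mk _

/-- **`I_x ≃ₜ* Ẑ`** («`I_x ≅ Ẑ(1)`», abstractly). [cite: MochizukiSemiAnbd2006, §6 p.71] -/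
def inertiaEquivκ₂ : ↥(cuspDecompκ₂ p ⊓ (augκ p).toMonoidHom.ker) ≃ₜ* ZHat :=
  (inertiaSubgroupEquivκ₂ p).trans cSqAxisGfpEquiv

/-! ## §3. The records `curveκ₂`, `modelκ₂` -/

/-- **The cusped Krull curve with the square-axis cusp**: `curveκ` with `Pt := Unit`, the point a cusp,
`D_x := c^{2Ẑ} ⋊ G_{ℚ_p}`. [cite: MochizukiEtTh2009, §1 p.13] -/
abbrev curveκ₂ : TemperedCurve p where
  K := (curveκ p).K
  finiteDimensional_K := (curveκ p).finiteDimensional_K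
  PiTemp := PiTpκ p
  aug := augκ p
  range_aug := (curveκ p).range_aug
  PiHat := PiHtκ p
  toHat := toHatκ p
  isProfiniteCompletion_toHat := isProfiniteCompletion_toHatκ p
  toHat_injective := toHatκ_injective p
  augHat := augHatκ p
  augHat_comp := (curveκ p).augHat_comp
  Pt := Unit
  IsCusp _ := True
  decomp _ := cuspDecompκ₂ p
  isClosed_decomp _ := isClosed_cuspDecompκ₂ p
  isOpen_aug_decomp _ := by rw [augκ_image_cuspDecompκ₂]; exact isOpen_univ
  inertia_eq_bot _ h := (h trivial).elim
  inertia_equiv_zHat _ _ := ⟨inertiaEquivκ₂ p⟩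

/-- [cite: MochizukiEtTh2009, §1 p.12] -/
theorem curveκ₂_deltaTemp : (curveκ₂ p).DeltaTemp = (curveκ p).DeltaTemp := rfl
/-- [cite: MochizukiEtTh2009, §1 p.12] -/
theorem curveκ₂_deltaHat : (curveκ₂ p).DeltaHat = (curveκ p).DeltaHat := rfl

/-- Re-keyed `Normal` instance at `curveκ₂`. [cite: MochizukiEtTh2009, §1 p.12] -/
instance thetaKerκ₂_normal : (CurveTheta.thetaKer (curveκ₂ p)).Normal := CurveTheta.thetaKer_normal _
/-- Re-keyed `Normal` instance at `curveκ₂`. [cite: MochizukiEtTh2009, §1 p.12] -/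
instance ellKerκ₂_normal : (CurveTheta.ellKer (curveκ₂ p)).Normal := CurveTheta.ellKer_normal _

/-- `thetaKer ⊓ YNκ ≤ ZNκ` read at `curveκ₂`. [cite: MochizukiEtTh2009, §1 p.14] -/
theorem thetaKer_inf_YNκ_le_ZNκ₂ (N : ℕ+) : CurveTheta.thetaKer (curveκ₂ p) ⊓ YNκ p N ≤ ZNκ p N :=
  thetaKer_inf_YNκ_le_ZNκ p N

/-- **The cusped Krull record with the square-axis cusp** — abc-iut-L2-t10's `modelκ′` VERBATIM over `curveκ₂`.
[cite: MochizukiEtTh2009, §1 p.11] -/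
abbrev _root_.Literature.AnabelianGeometry.EtaleTheta.ThetaSetting.modelκ₂ : ThetaSetting p where
  toTemperedCurve := curveκ₂ p
  qX := qModel p
  qX_mem := qModel_mem_botχ p
  norm_qX_lt_one := (ThetaSetting.model p).norm_qX_lt_one
  qX_ne_zero := qModel_ne_zeroχ p
  sqrtqX := ((p : ℕ) : PadicAlgCl p)
  sqrtqX_sq := rfl
  toZ := (krullTwistData p).toZ
  toZ_surjective := (krullTwistData p).toZ_surjective
  isOpen_ker_toZ := (krullTwistData p).isOpen_ker_toZ (continuous_leftRightκ p)
  toZ_delta_surjective := (krullTwistData p).toZ_restrict_surjective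
  GtpTheta := CurveTheta.GTheta (curveκ₂ p)
  toTheta := CurveTheta.toTheta (curveκ₂ p)
  continuous_toTheta := CurveTheta.continuous_toTheta (curveκ₂ p)
  toTheta_surjective := CurveTheta.toTheta_surjective (curveκ₂ p)
  ker_toTheta := CurveTheta.ker_toTheta (curveκ₂ p)
  GtpEll := CurveTheta.GEll (curveκ₂ p)
  thetaToEll := CurveTheta.thetaToEll (curveκ₂ p)
  continuous_thetaToEll := CurveTheta.continuous_thetaToEll (curveκ₂ p)
  thetaToEll_surjective := CurveTheta.thetaToEll_surjective (curveκ₂ p)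
  ker_toEll := CurveTheta.ker_toEll (curveκ₂ p)
  ker_thetaToEll_comm := CurveTheta.ker_thetaToEll_comm (curveκ₂ p)
  ker_thetaToEll_central := CurveTheta.ker_thetaToEll_central (curveκ₂ p)
  GtpYN := YNκ p
  GtpYN_one := YNκ_one p
  GtpYN_le := YNκ_le p
  map_aug_GtpYN N := map_rightHom_YNκ p N
  GtpYN_normal := YNκ_normal p
  isOpen_GtpYN N := isOpen_YNκ p (continuous_leftRightκ p) N (isOpen_fixingSubgroup_fieldKN ⊥ (qModel p) N)
  GtpYN_anti M N h := YNκ_anti p h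
  relIndex_deltaYN N := relIndex_YNκ p N
  GtpZN := ZNκ p
  GtpZN_le := ZNκ_le_YNκ p
  map_aug_GtpZN N := map_rightHom_ZNκ p N
  GtpZN_normal := ZNκ_normal p
  isOpen_GtpZN N := isOpen_ZNκ p (continuous_leftRightκ p) N (isOpen_fixingSubgroup_fieldJN ⊥ (qModel p) N)
  GtpZN_anti M N h := ZNκ_anti p h
  relIndex_deltaZN N := relIndex_ZNκ p N
  ker_toTheta_le_GtpZN N := by
    rw [CurveTheta.ker_toTheta]
    exact thetaKer_inf_YNκ_le_ZNκ₂ p N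

/-- **`modelκ₂` satisfies the guard `IsEtThOrigin`.** [cite: MochizukiEtTh2009, §1 p.12] -/
theorem _root_.Literature.AnabelianGeometry.EtaleTheta.ThetaSetting.modelκ₂_isEtThOrigin :
    (ThetaSetting.modelκ₂ p).IsEtThOrigin :=
  ThetaSetting.IsEtThOrigin.of_free (isFreeProfiniteOnTwo_deltaHatκ p)

/-- `toZ = pr₂ ∘ left`. [cite: MochizukiEtTh2009, §1 p.12] -/
theorem toZ_modelκ₂_apply (g : PiTpκ p) : (ThetaSetting.modelκ₂ p).toZ g = gfpSnd g.left := rfl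

/-- **(P3)** the cusp's decomposition group lies in `Π^tp_Y`. [cite: MochizukiEtTh2009, §1 p.13] -/
theorem decomp_modelκ₂_le_ker_toZ (x : (ThetaSetting.modelκ₂ p).Pt) :
    (ThetaSetting.modelκ₂ p).decomp x ≤ (ThetaSetting.modelκ₂ p).toZ.ker := fun g hg => by
  rw [MonoidHom.mem_ker, toZ_modelκ₂_apply]
  exact cSqAxisGfp_le_ker_gfpSnd ((mem_cuspDecompκ₂_iff p g).mp hg)

/-- **(P4)** `D_x ↠ G_K`. [cite: MochizukiEtTh2009, §1 p.13] -/
theorem map_aug_decomp_modelκ₂ (x : (ThetaSetting.modelκ₂ p).Pt) :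
    ((ThetaSetting.modelκ₂ p).decomp x).map (ThetaSetting.modelκ₂ p).aug.toMonoidHom = (ThetaSetting.modelκ₂ p).GK := by
  change (cuspDecompκ₂ p).map (augκ p).toMonoidHom = (⊥ : IntermediateField ℚ_[p] _).fixingSubgroup
  rw [map_augκ_cuspDecompκ₂, IntermediateField.fixingSubgroup_bot]

/-- **(P2)** there is a cusp. [cite: MochizukiEtTh2009, §1 p.12] -/
theorem exists_isCusp_modelκ₂ : ∃ x : (ThetaSetting.modelκ₂ p).Pt, (ThetaSetting.modelκ₂ p).IsCusp x := ⟨(), trivial⟩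

/-- **(P1)** `Ker(Π_X → G_{ℚ_p}) = Δ̂_X`. [cite: MochizukiEtTh2009, §1 p.12] -/
theorem ker_augHat_modelκ₂ : (ThetaSetting.modelκ₂ p).augHat.toMonoidHom.ker = (ThetaSetting.modelκ₂ p).DeltaHat := by
  change (augHatκ p).toMonoidHom.ker = (curveκ p).DeltaHat
  rw [deltaHatκ_eq]
  rfl

/-- The group-level datum at `curveκ₂` (same `Π^tp`, `aug` as `curveκ`). [cite: MochizukiSemiAnbd2006, Ex 3.10 p.43] -/
theorem nonempty_groupLevelData_curveκ₂ : Nonempty (TemperedCurve.GroupLevelData (curveκ₂ p)) := by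
  have hker : ((curveκ₂ p).augK (curveκ₂ p).galoisIdentification).toMonoidHom.ker = (curveκ₂ p).DeltaTemp :=
    (curveκ₂ p).ker_augK _
  exact ⟨{ galEquiv := (curveκ₂ p).galoisIdentification
           isTempered := isTempered_piTemp_curveκ p
           isTempered_ker := by rw [hker, curveκ₂_deltaTemp]; exact isTempered_deltaTemp_curveκ p
           isSlimGroup := isSlimGroup_PiTpκ p
           isSlimGroup_ker := by rw [hker, curveκ₂_deltaTemp]; exact isSlimGroup_deltaTempκ p
           secondCountableTopology := secondCountableTopology_PiTpκ p }⟩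

/-- **The once-punctured parameters of `modelκ₂` are inhabited with NO binder.** [cite: MochizukiEtTh2009, §1 p.13] -/
theorem nonempty_oncePuncturedData_modelκ₂ : Nonempty (ThetaSetting.modelκ₂ p).OncePuncturedData :=
  ⟨{ toGroupLevelData := (nonempty_groupLevelData_curveκ₂ p).some
     ker_augHat := ker_augHat_modelκ₂ p
     exists_cusp := exists_isCusp_modelκ₂ p
     decomp_le_ker_toZ := fun x _ => decomp_modelκ₂_le_ker_toZ p x
     map_aug_decomp := fun x _ => map_aug_decomp_modelκ₂ p x
     origin := ThetaSetting.modelκ₂_isEtThOrigin p }⟩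

/-- `I_x = inl(c^{2Ẑ})` at `modelκ₂`. [cite: MochizukiSemiAnbd2006, §6 p.71] -/
theorem inertia_modelκ₂_eq (x : (ThetaSetting.modelκ₂ p).Pt) :
    (ThetaSetting.modelκ₂ p).inertia x = cSqAxisGfp.map (SemidirectProduct.inl : Gfp →* PiTpκ p) :=
  cuspDecompκ₂_inf_ker p

end Literature.AnabelianGeometry.EtaleTheta.SettingModel

end
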